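import Mathlib
import Summits.Ventures.HodgeRepro2.A1GaloisDescentSubspace
import Summits.Ventures.HodgeRepro2.A1EigenlinePermutation
import Summits.Ventures.HodgeRepro2.A1ExteriorBaseChange

/-!
# Descent of the split summand: the kernel form of «constructed by descent from the split case»

Blind cell `pub-hodge-repro2`, seat p7 (gen 10), A1 annex (route/T4-A1-p7.md, Lemma A1.3's first
sentence; route/LEAN-ANNEX-p7.md §4).  Lemma A1.3 (after Deligne, Lemma 4.3(b)) says that the
subspace `⊕_σ ⋀^n_L V_σ ⊂ ⋀^n_L (L ⊗ V)` — the «split summand», `V_σ` the eigenlines of the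
`F`-action for the embeddings `σ : F → L` — is defined over `K`: it is the base change of a
`K`-subspace of `⋀^n_K V`.  This file glues the three kernel pieces already landed into exactly
that statement, with no geometry and no finiteness of `V` beyond a basis:

* the eigenlines are permuted by the Galois action (`A1EigenlinePermutation.act_mem_eigenline`);
* the base-change isomorphism `L ⊗_K ⋀^n_K V ≃ ⋀^n_L (L ⊗_K V)` carries `τ ⊗ id` to the action
  `actExt τ = ⋀^n (τ ⊗ id)` on wedges (`A1ExteriorBaseChange.actExt_ιMulti`);
* a Galois-stable `L`-subspace of `L ⊗_K W` is the base change of a `K`-subspace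
  (`A1GaloisDescentSubspace.exists_baseChange_eq`).

Main statements: `splitSummand n U = ⨆ i, range (⋀^n (U i).subtype)` for any family `U` of
`L`-subspaces; `splitSummand_stable` (a wedge-compatible `τ`-semilinear map permuting the family
maps the summand into itself); `actExt_splitSummand_le` for the eigenlines; `isGalStable_comap`
(its preimage in `L ⊗_K ⋀^n_K V` is Galois-stable) and **`exists_baseChange_eq_comap_splitSummand`**
(it is `W₀ ⊗ L` for a `K`-subspace `W₀ ⊆ ⋀^n_K V`).

What stays prose (A1 §4): that the descended `W₀` is Deligne's `∧^n_F V` (his identification), the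
decomposition `L ⊗ V = ⊕_σ V_σ` itself (not needed for the descent), and the geometry
(`V = H¹(B, ℚ)` with its `F`-action).

README §8(d): uses an L-value-free non-vanishing device: NO.
-/

namespace Summit.Ventures.HodgeRepro2.A1SplitSummandDescent

open TensorProduct
open Summit.Ventures.HodgeRepro2.A1GaloisDescentSubspace
open Summit.Ventures.HodgeRepro2.A1EigenlinePermutation
open Summit.Ventures.HodgeRepro2.A1ExteriorBaseChange

section Wedges

variable {R W : Type*} [CommRing R] [AddCommGroup W] [Module R W] (n : ℕ)

/-- The wedges `w₁ ∧ … ∧ wₙ` with every `w_i` in the submodule `p`. -/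
def wedges (p : Submodule R W) : Set (⋀[R]^n W) :=
  {x | ∃ w : Fin n → W, (∀ i, w i ∈ p) ∧ exteriorPower.ιMulti R n w = x}

/-- The image of `⋀^n p → ⋀^n W` is the span of the wedges of elements of `p`. -/
theorem range_map_subtype_eq_span (p : Submodule R W) :
    LinearMap.range (exteriorPower.map n p.subtype) = Submodule.span R (wedges n p) := by
  rw [LinearMap.range_eq_map, ← exteriorPower.ιMulti_span, Submodule.map_span]
  congr 1
  ext x
  constructor
  · rintro ⟨_, ⟨v, rfl⟩, rfl⟩
    exact ⟨fun i => (v i : W), fun i => (v i).2, by rw [exteriorPower.map_apply_ιMulti]; rfl⟩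
  · rintro ⟨w, hw, rfl⟩
    exact ⟨exteriorPower.ιMulti R n (fun i => ⟨w i, hw i⟩), ⟨_, rfl⟩,
      by rw [exteriorPower.map_apply_ιMulti]; rfl⟩

/-- The split summand of a family `U` of submodules of `W`: `⨆ i, ⋀^n (U i) ⊆ ⋀^n W`
(the `⊕_σ ⋀^n V_σ ⊂ ⋀^n (⊕_σ V_σ)` of Lemma A1.3 / Deligne 4.3(b), read inside `⋀^n W`). -/
noncomputable def splitSummand {ι : Type*} (U : ι → Submodule R W) : Submodule R (⋀[R]^n W) :=
  ⨆ i, LinearMap.range (exteriorPower.map n (U i).subtype)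

/-- A wedge of elements of `U i` lies in the split summand. -/
theorem ιMulti_mem_splitSummand {ι : Type*} (U : ι → Submodule R W) (i : ι) (w : Fin n → W)
    (hw : ∀ j, w j ∈ U i) : exteriorPower.ιMulti R n w ∈ splitSummand n U :=
  Submodule.mem_iSup_of_mem i (by
    rw [range_map_subtype_eq_span]
    exact Submodule.subset_span ⟨w, hw, rfl⟩)

end Wedges

section Stable

variable {K L W : Type*} [Field K] [Field L] [Algebra K L] [AddCommGroup W] [Module K W]
  [Module L W] [IsScalarTower K L W] (n : ℕ)

/-- **Stability of a span of wedges** under a `τ`-semilinear map `f` of `⋀^n W` acting on wedges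
through a map `g` of `W` (`f (w₁ ∧ … ∧ wₙ) = g w₁ ∧ … ∧ g wₙ`): if `g` maps `p` into `p'`, then
`f` maps `span (wedges p)` into `span (wedges p')`. -/
theorem map_span_wedges_le (f : ⋀[L]^n W →ₗ[K] ⋀[L]^n W) (τ : L → L)
    (hf : ∀ (c : L) (x : ⋀[L]^n W), f (c • x) = τ c • f x) (g : W → W)
    (hfg : ∀ w : Fin n → W, f (exteriorPower.ιMulti L n w) = exteriorPower.ιMulti L n (g ∘ w))
    (p p' : Submodule L W) (hg : ∀ x ∈ p, g x ∈ p') :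
    ∀ x ∈ Submodule.span L (wedges n p), f x ∈ Submodule.span L (wedges n p') := by
  intro x hx
  induction hx using Submodule.span_induction with
  | mem x hx =>
    obtain ⟨w, hw, rfl⟩ := hx
    rw [hfg]
    exact Submodule.subset_span ⟨g ∘ w, fun i => hg _ (hw i), rfl⟩
  | zero => simp
  | add x y _ _ hx hy => rw [map_add]; exact Submodule.add_mem _ hx hy
  | smul c x _ hx => rw [hf]; exact Submodule.smul_mem _ _ hx

/-- **Stability of the split summand** under a `τ`-semilinear wedge-compatible map `f` whose
underlying map `g` permutes the family: `g (U i) ⊆ U (π i)`. -/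
theorem splitSummand_stable {ι : Type*} (U : ι → Submodule L W) (π : ι → ι)
    (f : ⋀[L]^n W →ₗ[K] ⋀[L]^n W) (τ : L → L)
    (hf : ∀ (c : L) (x : ⋀[L]^n W), f (c • x) = τ c • f x) (g : W → W)
    (hfg : ∀ w : Fin n → W, f (exteriorPower.ιMulti L n w) = exteriorPower.ιMulti L n (g ∘ w))
    (hg : ∀ i, ∀ x ∈ U i, g x ∈ U (π i)) :
    ∀ x ∈ splitSummand n U, f x ∈ splitSummand n U := by
  intro x hx
  refine Submodule.iSup_induction (fun i => LinearMap.range (exteriorPower.map n (U i).subtype))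
    (motive := fun x => f x ∈ splitSummand n U) hx ?_ (by simp) ?_
  · intro i x hx
    rw [range_map_subtype_eq_span] at hx
    refine Submodule.mem_iSup_of_mem (π i) ?_
    rw [range_map_subtype_eq_span]
    exact map_span_wedges_le n f τ hf g hfg (U i) (U (π i)) (hg i) x hx
  · intro x y hx hy
    rw [map_add]
    exact Submodule.add_mem _ hx hy

end Stable

section Eigenlines

variable (K L : Type*) [Field K] [Field L] [Algebra K L]
variable (F : Type*) [CommRing F] [Algebra K F]
variable (V : Type*) [AddCommGroup V] [Module K V] [Module F V] [IsScalarTower K F V]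
variable (n : ℕ) {I : Type*} [LinearOrder I]

/-- `act τ` (= `A1GaloisDescentSubspace.act`, the `τ ⊗ id` of the descent file) is
`A1ExteriorBaseChange.coeffAct V τ` — the same linear map. -/
theorem act_eq_coeffAct (τ : L ≃ₐ[K] L) : act (V := V) τ = coeffAct V τ := rfl

/-- The split summand of the eigenlines inside `⋀^n_L (L ⊗_K V)`:
`⨆_σ ⋀^n (eigenline σ)`, `σ` ranging over the `K`-embeddings `F →ₐ[K] L`. -/
noncomputable def eigenSummand : Submodule L (⋀[L]^n (L ⊗[K] V)) :=
  splitSummand n (fun σ : F →ₐ[K] L => eigenline L V σ)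

/-- **The eigen-summand is Galois-stable** under the transported action `actExt τ = ⋀^n (τ ⊗ id)`
(the Galois action permutes the eigenlines, `act_mem_eigenline`). -/
theorem actExt_eigenSummand_le (b : Module.Basis I K V) (τ : L ≃ₐ[K] L) :
    ∀ x ∈ eigenSummand K L F V n, actExt b τ x ∈ eigenSummand K L F V n := by
  refine splitSummand_stable n (fun σ : F →ₐ[K] L => eigenline L V σ)
    (fun σ => (τ : L →ₐ[K] L).comp σ) (actExt b τ) τ (actExt_smul b τ) (coeffAct V τ) ?_ ?_
  · intro w
    rw [actExt_ιMulti b (Module.Free.chooseBasis K L) τ w]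
    rfl
  · intro σ x hx
    exact act_mem_eigenline τ σ hx

/-- The eigen-summand pulled back to `L ⊗_K ⋀^n_K V` through the base-change isomorphism. -/
noncomputable def eigenSummandK (b : Module.Basis I K V) : Submodule L (L ⊗[K] ⋀[K]^n V) :=
  (eigenSummand K L F V n).comap
    (baseChangeEquiv K L V n b : L ⊗[K] ⋀[K]^n V →ₗ[L] ⋀[L]^n (L ⊗[K] V))

/-- Membership in the pulled-back summand. -/
theorem mem_eigenSummandK_iff (b : Module.Basis I K V) (x : L ⊗[K] ⋀[K]^n V) :
    x ∈ eigenSummandK K L F V n b ↔ baseChangeEquiv K L V n b x ∈ eigenSummand K L F V n := by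
  simp [eigenSummandK]

/-- The base-change isomorphism maps the pulled-back summand onto the eigen-summand. -/
theorem map_eigenSummandK (b : Module.Basis I K V) :
    (eigenSummandK K L F V n b).map
      (baseChangeEquiv K L V n b : L ⊗[K] ⋀[K]^n V →ₗ[L] ⋀[L]^n (L ⊗[K] V)) =
      eigenSummand K L F V n :=
  Submodule.map_comap_eq_of_surjective (baseChangeEquiv K L V n b).surjective _

/-- **The pulled-back summand is Galois-stable** in the sense of the descent file
(`A1GaloisDescentSubspace.IsGalStable`, for `act τ = τ ⊗ id` on `L ⊗_K ⋀^n_K V`). -/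
theorem isGalStable_eigenSummandK (b : Module.Basis I K V) :
    IsGalStable (eigenSummandK K L F V n b) := by
  intro τ x hx
  rw [mem_eigenSummandK_iff] at hx ⊢
  have h := actExt_eigenSummand_le K L F V n b τ _ hx
  rwa [actExt_apply, LinearEquiv.symm_apply_apply, ← act_eq_coeffAct] at h

/-- **Descent of the split summand** (Lemma A1.3's «constructed by descent from the split case»,
Deligne 4.3(b)): for `L/K` finite Galois, the eigen-summand `⊕_σ ⋀^n V_σ ⊂ ⋀^n_L (L ⊗_K V)`,
read in `L ⊗_K ⋀^n_K V`, is the base change of a `K`-subspace `W₀ ⊆ ⋀^n_K V`. -/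
theorem exists_baseChange_eq_eigenSummandK [FiniteDimensional K L] [IsGalois K L]
    (b : Module.Basis I K V) :
    ∃ W₀ : Submodule K (⋀[K]^n V), W₀.baseChange L = eigenSummandK K L F V n b :=
  exists_baseChange_eq _ (isGalStable_eigenSummandK K L F V n b)

/-- The same, stated in `⋀^n_L (L ⊗_K V)`: the eigen-summand is the image of `W₀ ⊗ L` under the
base-change isomorphism. -/
theorem exists_map_baseChange_eq_eigenSummand [FiniteDimensional K L] [IsGalois K L]
    (b : Module.Basis I K V) :
    ∃ W₀ : Submodule K (⋀[K]^n V), (W₀.baseChange L).map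
      (baseChangeEquiv K L V n b : L ⊗[K] ⋀[K]^n V →ₗ[L] ⋀[L]^n (L ⊗[K] V)) =
        eigenSummand K L F V n := by
  obtain ⟨W₀, hW₀⟩ := exists_baseChange_eq_eigenSummandK K L F V n b
  exact ⟨W₀, by rw [hW₀, map_eigenSummandK]⟩

end Eigenlines

section GaloisSelf

variable (K F : Type*) [Field K] [Field F] [Algebra K F] [FiniteDimensional K F] [IsGalois K F]
variable (V : Type*) [AddCommGroup V] [Module K V] [Module F V] [IsScalarTower K F V]
variable (n : ℕ) {I : Type*} [LinearOrder I]

/-- **Over the Galois CM field itself** (`L = F`, `F/K` finite Galois): the split summand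
`⊕_{σ : F → F} ⋀^n V_σ ⊂ ⋀^n_F (F ⊗_K V)`, read in `F ⊗_K ⋀^n_K V`, is `W₀ ⊗ F` for a `K`-subspace
`W₀ ⊆ ⋀^n_K V` — Lemma A1.3's descent with the splitting field `F` of (A0.4). -/
theorem exists_baseChange_eq_eigenSummandK_self (b : Module.Basis I K V) :
    ∃ W₀ : Submodule K (⋀[K]^n V), W₀.baseChange F = eigenSummandK K F F V n b :=
  exists_baseChange_eq_eigenSummandK K F F V n b

end GaloisSelf

end Summit.Ventures.HodgeRepro2.A1SplitSummandDescent
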